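import Summits.ResolutionOfSingularities.ResolutionOfSingularities.Theorems.WeightedInvariantIotaOrderSemicontinuous
import Summits.ResolutionOfSingularities.ResolutionOfSingularities.Theorems.WeightedInvariantIotaOrder
import HarnessLib

/-!
# Clause (c8) `IotaUpperSemicontinuous` holds for the order function `iotaOrd` (door H2a‴, first ι-instance)

Topic: `Summits/ResolutionOfSingularities/ResolutionOfSingularities/Theorems`. Helper for the door item
`HypersurfaceCentreConstruction` (statement `stmt-ResolutionOfSingularities-19897`, route `WeightedInvariant`):
the conjunct (c8) of the tree's clause module `WeightedInvariantHypersurfaceLocalGameEFT3`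
(`LocalEngine.IotaUpperSemicontinuous`, res-L1-w43-plan-1 eft_sketch v6–v8) at the first ι-instance
`LocalEngine.iotaOrd` of ORDER (o11) (res-type-073, `WeightedInvariantIotaOrder`): **for `Y` smooth and
quasi-compact over any field `k₀`, `f ∈ Γ(Y, 𝒪_Y)` and every ordinal `α`, the super-level set
`{y | α ≤ iotaOrd 𝒪_{Y,y} f_y}` is closed.**  One line over the generic adapter
`isClosed_setOf_le_ordinal_adicOrder_germ` (res-type-039, `WeightedInvariantIotaOrderSemicontinuous`, on top of
the Diff-free u.s.c. of the order `WeightedInvariantOrderSemicontinuousSmooth`): on the local ring `𝒪_{Y,y}`,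
`iotaOrd = ordOfENat ∘ adicOrder` (`iotaOrd_eq_ordOfENat_adicOrder`) and `ordOfENat n = n` on the naturals
(`ordOfENat_natCast`; its value `ω` at `⊤` is immaterial).  res-L1-w43-plan-1 RULING 2026-08-27T05:32:15Z (2)(b).

[OURS · L1 W4.3] Replaces the role of NO printed item; NOT a statement of the manuscript
[claim: Hironaka2017, status: under-review]. AI work, weaker than expert review.

## References

* V. Cossart, O. Piltant, J. Algebra 320 (2008), proof of Prop. 4.2 (u.s.c. of the order on regular excellent
  schemes). [cite: CossartPiltant2008, Prop. 4.2 (proof)]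
-/

noncomputable section

open CategoryTheory AlgebraicGeometry TopologicalSpace IsLocalRing
open Literature.AlgebraicGeometry.Resolution
open Summit.ResolutionOfSingularities.ResolutionOfSingularities.Theorems

set_option linter.dupNamespace false -- mandated namespace of this single-conjunct summit

namespace Summit.ResolutionOfSingularities.ResolutionOfSingularities.Cruxes.HypersurfaceCentreConstruction.LocalEngine

/-- On a stalk (a local ring) the super-level sets of `iotaOrd` are those of `ordOfENat ∘ adicOrder` of the germ.
[folklore] -/
theorem setOf_le_iotaOrd_stalk_eq (Y : Scheme.{0}) (f : Γ(Y, ⊤)) (α : Ordinal.{0}) :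
    {y : ↥Y | α ≤ iotaOrd (Y.presheaf.stalk y) (Y.presheaf.germ ⊤ y trivial f)} =
      {y : ↥Y | α ≤ ordOfENat (adicOrder ((Y.presheaf.germ ⊤ y trivial).hom f))} := by
  ext y
  rw [Set.mem_setOf_eq, Set.mem_setOf_eq, iotaOrd_eq_ordOfENat_adicOrder]

/-- **(c8) for the order function**: `IotaUpperSemicontinuous iotaOrd` — on a smooth quasi-compact scheme over
ANY field every super-level set `{y | α ≤ iotaOrd 𝒪_{Y,y} f_y}` (`α` an ordinal) is closed.  From the generic
adapter `isClosed_setOf_le_ordinal_adicOrder_germ` with `φ := ordOfENat`. [OURS · L1 W4.3 · door H2a‴ (c8)]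
[cite: CossartPiltant2008, Prop. 4.2 (proof)] -/
theorem iotaOrd_upperSemicontinuous : IotaUpperSemicontinuous iotaOrd := by
  intro k₀ _ Y hY _ _ f α
  rw [setOf_le_iotaOrd_stalk_eq]
  exact isClosed_setOf_le_ordinal_adicOrder_germ k₀ Y hY f ordOfENat ordOfENat_natCast α

end Summit.ResolutionOfSingularities.ResolutionOfSingularities.Cruxes.HypersurfaceCentreConstruction.LocalEngine

end
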